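import Literature.NumberTheory.EllipticCurves.LocalIndexBadPoints
import HarnessLib

/-!
# Bad points of the Tate normal form `y² + xy = x³ + απⁿ`: shapes and sums

Computations with `K`-points of `J : y² + xy = x³ + απⁿ` (`α ∈ Rˣ`, `n ≥ 1`) over a discrete
valuation ring `R` — the normal form of a split multiplicative equation over a Henselian ring
(`SplitMultiplicativeNormalForm.lean`) — used by `NeronComponentIndexSplitProofs.lean` to bound
`[E(K) : E₀(K)] ≤ n` (the half `≤` of Silverman, *ATAEC*, Cor. IV.9.2(d) / Prop. V.4.1: for
split multiplicative reduction `E(K)/E₀(K)` has order `v(Δ) = n`; the half `≥` is the tree's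
`exists_fin_injective_quotient_goodReductionSubgroup`).

* `hasNonsingularReduction_add_of_slope'`: the sum lemma of `LocalIndexBadPoints` without the
  hypothesis `a₁, a₂ ∈ 𝔪`: if `N = πᵉu`, `πᵉ ∣ D` and, when `D/πᵉ` is a unit, the residue of the
  slope `λ = u/(D/πᵉ)` is not a root of `T² + ā₁T − ā₂`, then `P₁ + P₂ ∈ E₀(K)`.
* `shape_of_bad` (the classification, cf. *ATAEC*, V.4, Lemma 4.1.2): a point `(x, y)` of `J(K)`
  with `x, y ∈ 𝔪` is of **low** shape `(πⁱu, πⁱut)` with `u ∈ Rˣ`, `1 ≤ i`, `2i < n` and `t ∈ 𝔪`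
  (branch `0`) or `t + 1 ∈ 𝔪` (branch `−1`) — from `t² + t = x + απⁿ/x² ∈ 𝔪` — or of **middle**
  shape `(πʰx', πʰy')` with `n = 2h`, `y' ∈ Rˣ`.
* `add_low`, `add_middle`: a branch-`0` and a branch-`−1` point of the same level, resp. two
  middle points, add up into `E₀(K)` (`λ̄ = ū₂/(ū₁ − ū₂)`, resp. `−ȳ₃'/(ȳ₁' + ȳ₃' + x̄₁')`, is
  not in `{0, −1}`).

## References

* J. H. Silverman, *Advanced Topics in the Arithmetic of Elliptic Curves*, GTM 151, Springer
  1994, Cor. IV.9.2(d) (PDF p. 340); V.4, Prop. 4.1 and Lemmas 4.1.1–4.1.4 (PDF pp. 402–405).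
  [SilvermanATAEC1994]
-/

noncomputable section

open scoped Classical

open IsLocalRing

namespace Literature.NumberTheory.EllipticCurves

namespace LocalIndex

open DiophantineGeometry DiophantineGeometry.TateAlgorithm

variable {R : Type*} [CommRing R] [IsDomain R] [IsDiscreteValuationRing R]
  {K : Type*} [Field K] [Algebra R K] [IsFractionRing R K]

/-! ### The sum lemma with a root condition -/

/-- **Sum of two bad points, general tangent cone.** Let `a₃, a₄, a₆ ∈ 𝔪`, `P₁ = (x₁, y₁)`,
`P₂ = (x₂, y₂)` integral points with `x₁, x₂ ∈ 𝔪`, `N = x₁² + x₁x₂ + x₂² + a₂(x₁ + x₂) + a₄ −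
a₁y₂ = πᵉu` with `u ∈ Rˣ` and `D = y₁ + y₂ + a₁x₁ + a₃ = πᵉd`. If, whenever `d` is a unit with
inverse `d'`, `(ud')² + a₁(ud') − a₂ − x₁ − x₂` is a unit (i.e. `λ̄ = ū/d̄` is not a root of
`T² + ā₁T − ā₂`), then `P₁ + P₂ ∈ E₀(K)` (slope `λ = N/D`: either `λ ∈ Rˣ` with unit
`x₃ = λ² + a₁λ − a₂ − x₁ − x₂`, or `v(λ) < 0` and reduction `𝒪`). [folklore] -/
theorem hasNonsingularReduction_add_of_slope' (I : WeierstrassCurve R) {ϖ : R}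
    (hϖ : Irreducible ϖ) (e : ℕ) (h3 : I.a₃ ∈ maximalIdeal R) (h4 : I.a₄ ∈ maximalIdeal R)
    (h6 : I.a₆ ∈ maximalIdeal R) {x₁ y₁ x₂ y₂ u d : R} (hu : IsUnit u)
    (hN : x₁ ^ 2 + x₁ * x₂ + x₂ ^ 2 + I.a₂ * (x₁ + x₂) + I.a₄ - I.a₁ * y₂ = ϖ ^ e * u)
    (hD : y₁ + y₂ + I.a₁ * x₁ + I.a₃ = ϖ ^ e * d)
    (hroot : ∀ d' : R, d * d' = 1 → IsUnit ((u * d') ^ 2 + I.a₁ * (u * d') - I.a₂ - x₁ - x₂))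
    (h₁ : (I.baseChange K).toAffine.Nonsingular (algebraMap R K x₁) (algebraMap R K y₁))
    (h₂ : (I.baseChange K).toAffine.Nonsingular (algebraMap R K x₂) (algebraMap R K y₂)) :
    I.HasNonsingularReduction
      (WeierstrassCurve.Affine.Point.some _ _ h₁ + WeierstrassCurve.Affine.Point.some _ _ h₂) := by
  have hv := integers_valuationRing_valuation R K
  have hinj := IsFractionRing.injective R K
  by_cases hxy : algebraMap R K x₁ = algebraMap R K x₂ ∧
      algebraMap R K y₁ = (I.baseChange K).toAffine.negY (algebraMap R K x₂) (algebraMap R K y₂)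
  · rw [WeierstrassCurve.Affine.Point.add_of_Y_eq hxy.1 hxy.2]; trivial
  rw [WeierstrassCurve.Affine.Point.add_some hxy]
  have hLD := slope_mul_eq h₁.1 h₂.1 hxy
  have e1 : algebraMap R K y₁ + algebraMap R K y₂ +
      (I.baseChange K).toAffine.a₁ * algebraMap R K x₁ + (I.baseChange K).toAffine.a₃ =
        algebraMap R K (y₁ + y₂ + I.a₁ * x₁ + I.a₃) := by
    simp [WeierstrassCurve.baseChange]
  have e2 : algebraMap R K x₁ ^ 2 + algebraMap R K x₁ * algebraMap R K x₂ +
      algebraMap R K x₂ ^ 2 +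
      (I.baseChange K).toAffine.a₂ * (algebraMap R K x₁ + algebraMap R K x₂) +
      (I.baseChange K).toAffine.a₄ - (I.baseChange K).toAffine.a₁ * algebraMap R K y₂ =
        algebraMap R K (x₁ ^ 2 + x₁ * x₂ + x₂ ^ 2 + I.a₂ * (x₁ + x₂) + I.a₄ - I.a₁ * y₂) := by
    simp [WeierstrassCurve.baseChange]
  rw [e1, e2, hD, hN, map_mul, map_mul, map_pow, ← mul_assoc, mul_comm _ (algebraMap R K ϖ ^ e),
    mul_assoc] at hLD
  have hϖ0 : algebraMap R K ϖ ^ e ≠ 0 := pow_ne_zero _ ((map_ne_zero_iff _ hinj).mpr hϖ.ne_zero)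
  have hLd := mul_left_cancel₀ hϖ0 hLD
  by_cases hdu : IsUnit d
  · set ℓ : R := u * ↑hdu.unit⁻¹ with hℓ
    have hd0 : algebraMap R K d ≠ 0 := (map_ne_zero_iff _ hinj).mpr hdu.ne_zero
    have hLeq : (I.baseChange K).toAffine.slope (algebraMap R K x₁) (algebraMap R K x₂)
        (algebraMap R K y₁) (algebraMap R K y₂) = algebraMap R K ℓ := by
      rw [← mul_left_inj' hd0, hLd, hℓ, ← map_mul, mul_assoc, IsUnit.val_inv_mul, mul_one]
    have hX : (I.baseChange K).toAffine.addX (algebraMap R K x₁) (algebraMap R K x₂)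
        ((I.baseChange K).toAffine.slope (algebraMap R K x₁) (algebraMap R K x₂)
          (algebraMap R K y₁) (algebraMap R K y₂)) =
        algebraMap R K (ℓ ^ 2 + I.a₁ * ℓ - I.a₂ - x₁ - x₂) := by
      rw [WeierstrassCurve.Affine.addX, hLeq]; simp [WeierstrassCurve.baseChange]
    exact hasNonsingularReduction_some_of_isUnit I h3 h4 h6 (hroot _ hdu.mul_val_inv) _ hX
  · have hdlt : ValuationRing.valuation R K (algebraMap R K d) < 1 :=
      (v_algebraMap_lt_one_iff hv d).mpr ((residue_eq_zero_iff _).mpr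
        ((IsLocalRing.mem_maximalIdeal _).mpr hdu))
    have hLv : 1 < ValuationRing.valuation R K ((I.baseChange K).toAffine.slope
        (algebraMap R K x₁) (algebraMap R K x₂) (algebraMap R K y₁) (algebraMap R K y₂)) := by
      by_contra hle
      rw [not_lt] at hle
      have h1' := mul_le_mul' hle (le_refl (ValuationRing.valuation R K (algebraMap R K d)))
      rw [one_mul, ← Valuation.map_mul, hLd, (hv.isUnit_iff_valuation_eq_one).mp hu] at h1'
      exact (lt_irrefl _) (h1'.trans_lt hdlt)
    exact Or.inl ((not_mem_range_iff hv).mpr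
      (one_lt_v_addX_of_one_lt_v_slope hv (hv.map_le_one x₁) (hv.map_le_one x₂) hLv))

/-! ### Sums in the Tate normal form -/

section Tate

variable (J : WeierstrassCurve R) {ϖ : R}

/-- **A branch-`0` and a branch-`−1` point of the same level add up into `E₀`** (`a₁ = 1`,
`a₂ = a₃ = a₄ = 0`, `a₆ ∈ 𝔪`): for `P₁ = (πⁱu₁, πⁱu₁t₁)`, `P₂ = (πⁱu₂, πⁱu₂t₂)` with `u₁, u₂ ∈ Rˣ`,
`i ≥ 1`, `t₁ ∈ 𝔪`, `t₂ + 1 ∈ 𝔪`: `N = πⁱ·(ū₂ + …)`, `D = πⁱ·(ū₁ − ū₂ + …)`, and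
`λ̄ = ū₂/(ū₁ − ū₂) ∉ {0, −1}` (cf. Silverman, *ATAEC*, V.4, Lemma 4.1.4). [folklore] -/
theorem add_low (hϖ : Irreducible ϖ) (h1 : J.a₁ = 1) (h2 : J.a₂ = 0) (h3 : J.a₃ = 0)
    (h4 : J.a₄ = 0)
    (h6 : J.a₆ ∈ maximalIdeal R) {i : ℕ} (hi : 1 ≤ i) {u₁ u₂ t₁ t₂ : R} (hu₁ : IsUnit u₁)
    (hu₂ : IsUnit u₂) (ht₁ : t₁ ∈ maximalIdeal R) (ht₂ : t₂ + 1 ∈ maximalIdeal R)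
    (hP₁ : (J.baseChange K).toAffine.Nonsingular (algebraMap R K (ϖ ^ i * u₁))
      (algebraMap R K (ϖ ^ i * u₁ * t₁)))
    (hP₂ : (J.baseChange K).toAffine.Nonsingular (algebraMap R K (ϖ ^ i * u₂))
      (algebraMap R K (ϖ ^ i * u₂ * t₂))) :
    J.HasNonsingularReduction
      (WeierstrassCurve.Affine.Point.some _ _ hP₁ + WeierstrassCurve.Affine.Point.some _ _ hP₂) := by
  have hm : ϖ ∈ maximalIdeal R := (IsLocalRing.mem_maximalIdeal _).mpr hϖ.not_isUnit
  have hmi : ϖ ^ i ∈ maximalIdeal R := Ideal.pow_mem_of_mem _ hm i hi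
  have hres0 : residue R (ϖ ^ i) = 0 := (residue_eq_zero_iff _).mpr hmi
  have hrt₁ : residue R t₁ = 0 := (residue_eq_zero_iff _).mpr ht₁
  have hrt₂ : residue R t₂ = -1 := by
    have := (residue_eq_zero_iff _).mpr ht₂
    rw [map_add, map_one] at this; linear_combination this
  have hru₁ : residue R u₁ ≠ 0 := (isUnit_iff_residue_ne_zero _).mp hu₁
  have hru₂ : residue R u₂ ≠ 0 := (isUnit_iff_residue_ne_zero _).mp hu₂
  refine hasNonsingularReduction_add_of_slope' J hϖ i (h3 ▸ Ideal.zero_mem _)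
    (h4 ▸ Ideal.zero_mem _) h6 (u := ϖ ^ i * (u₁ ^ 2 + u₁ * u₂ + u₂ ^ 2) - u₂ * t₂)
    (d := u₁ * (1 + t₁) + u₂ * t₂) ?_ ?_ ?_ ?_ hP₁ hP₂
  · rw [isUnit_iff_residue_ne_zero]
    simp only [map_sub, map_mul, map_add, map_pow, hres0, hrt₂, zero_mul, zero_sub]
    simpa using hru₂
  · rw [h1, h2, h4]; ring
  · rw [h1, h3]; ring
  · intro d' hd'
    rw [isUnit_iff_residue_ne_zero, h1, h2]
    have hd'r : (residue R u₁ - residue R u₂) * residue R d' = 1 := by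
      have := congrArg (residue R) hd'
      simp only [map_mul, map_add, map_one, hrt₁, hrt₂] at this
      linear_combination this
    simp only [map_sub, map_add, map_mul, map_pow, hres0, hrt₂, zero_mul, zero_sub,
      sub_zero, one_mul]
    -- `λ̄ = ū₂ d'`, `λ̄ + 1 = ū₁ d'`: the product `ū₁ū₂d'²` is nonzero
    have hd'0 : residue R d' ≠ 0 := by
      intro h0; rw [h0, mul_zero] at hd'r; exact zero_ne_one hd'r
    intro h0
    apply mul_ne_zero (mul_ne_zero hru₂ hd'0) (mul_ne_zero hru₁ hd'0)
    linear_combination h0 + (residue R u₂ * residue R d') * hd'r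

/-- **Two middle points add up into `E₀`** (`a₁ = 1`, `a₂ = a₃ = a₄ = 0`, `a₆ = απ²ʰ`,
`α ∈ Rˣ`, `h ≥ 1`): for `P₁ = (πʰx₁, πʰy₁)`, `P₃ = (πʰx₃, πʰy₃)` with `y₃ ∈ Rˣ` (then
`ȳ₁(ȳ₁ + x̄₁) = ᾱ`): `N = πʰ·(−ȳ₃ + …)`, `D = πʰ(y₁ + y₃ + x₁)`, and
`λ̄ = −ȳ₃/(ȳ₁ + ȳ₃ + x̄₁) ∉ {0, −1}` because `ȳ₁ + x̄₁ ≠ 0`. [folklore] -/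
theorem add_middle (hϖ : Irreducible ϖ) (h1 : J.a₁ = 1) (h2 : J.a₂ = 0) (h3 : J.a₃ = 0)
    (h4 : J.a₄ = 0)
    {α : R} (hα : IsUnit α) {h : ℕ} (hh : 1 ≤ h) (h6 : J.a₆ = α * ϖ ^ (2 * h)) {x₁ y₁ x₃ y₃ : R}
    (hy₃ : IsUnit y₃)
    (hP₁ : (J.baseChange K).toAffine.Nonsingular (algebraMap R K (ϖ ^ h * x₁))
      (algebraMap R K (ϖ ^ h * y₁)))
    (hP₃ : (J.baseChange K).toAffine.Nonsingular (algebraMap R K (ϖ ^ h * x₃))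
      (algebraMap R K (ϖ ^ h * y₃))) :
    J.HasNonsingularReduction
      (WeierstrassCurve.Affine.Point.some _ _ hP₁ + WeierstrassCurve.Affine.Point.some _ _ hP₃) := by
  have hϖ0 : ϖ ≠ 0 := hϖ.ne_zero
  have hm : ϖ ∈ maximalIdeal R := (IsLocalRing.mem_maximalIdeal _).mpr hϖ.not_isUnit
  have hmh : ϖ ^ h ∈ maximalIdeal R := Ideal.pow_mem_of_mem _ hm h hh
  have hres0 : residue R (ϖ ^ h) = 0 := (residue_eq_zero_iff _).mpr hmh
  have hry₃ : residue R y₃ ≠ 0 := (isUnit_iff_residue_ne_zero _).mp hy₃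
  have hrα : residue R α ≠ 0 := (isUnit_iff_residue_ne_zero _).mp hα
  -- `ȳ₁ (ȳ₁ + x̄₁) = ᾱ` from the equation of `P₁`
  have hrel : residue R y₁ * (residue R y₁ + residue R x₁) = residue R α := by
    have he : J.toAffine.Equation (ϖ ^ h * x₁) (ϖ ^ h * y₁) :=
      (WeierstrassCurve.Affine.map_equation _ (IsFractionRing.injective R K) _ _).mp hP₁.left
    rw [WeierstrassCurve.Affine.equation_iff, h1, h2, h3, h4, h6] at he
    have he' : y₁ ^ 2 + x₁ * y₁ = ϖ ^ h * x₁ ^ 3 + α :=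
      mul_left_cancel₀ (pow_ne_zero (2 * h) hϖ0) (by rw [pow_mul]; linear_combination he)
    have := congrArg (residue R) he'
    simp only [map_add, map_pow, map_mul, hres0, zero_mul, zero_add] at this
    linear_combination this
  have h6m : J.a₆ ∈ maximalIdeal R := by
    rw [h6]; exact Ideal.mul_mem_left _ _ (Ideal.pow_mem_of_mem _ hm _ (by omega))
  refine hasNonsingularReduction_add_of_slope' J hϖ h (h3 ▸ Ideal.zero_mem _)
    (h4 ▸ Ideal.zero_mem _) h6m (u := ϖ ^ h * (x₁ ^ 2 + x₁ * x₃ + x₃ ^ 2) - y₃)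
    (d := y₁ + y₃ + x₁) ?_ ?_ ?_ ?_ hP₁ hP₃
  · rw [isUnit_iff_residue_ne_zero]
    simp only [map_sub, map_mul, hres0, zero_mul, zero_sub, ne_eq, neg_eq_zero]
    exact hry₃
  · rw [h1, h2, h4]; ring
  · rw [h1, h3]; ring
  · intro d' hd'
    rw [isUnit_iff_residue_ne_zero, h1, h2]
    have hd'r : (residue R y₁ + residue R y₃ + residue R x₁) * residue R d' = 1 := by
      have := congrArg (residue R) hd'
      simpa only [map_mul, map_add, map_one] using this
    simp only [map_sub, map_add, map_mul, map_pow, hres0, zero_mul, zero_sub, sub_zero, one_mul]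
    -- `λ̄ = -ȳ₃ d'`, `λ̄ + 1 = (ȳ₁ + x̄₁) d'`
    have hd'0 : residue R d' ≠ 0 := by
      intro h0; rw [h0, mul_zero] at hd'r; exact zero_ne_one hd'r
    have hsum : residue R y₁ + residue R x₁ ≠ 0 := by
      intro h0; rw [h0, mul_zero] at hrel; exact hrα hrel.symm
    intro h0
    apply mul_ne_zero (neg_ne_zero.mpr (mul_ne_zero hry₃ hd'0)) (mul_ne_zero hsum hd'0)
    linear_combination h0 - (residue R y₃ * residue R d') * hd'r

/-! ### The shapes of bad points -/

/-- **Shapes of bad points of the Tate normal form** (`a₁ = 1`, `a₂ = a₃ = a₄ = 0`, `a₆ = απⁿ`,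
`α ∈ Rˣ`, `n ≥ 1`). A solution `(x, y)` of the equation with `x, y ∈ 𝔪` is either of *low*
shape `x = πⁱu`, `y = πⁱut` with `u ∈ Rˣ`, `1 ≤ i`, `2i < n` and `t ∈ 𝔪` or `t + 1 ∈ 𝔪` (from
`u²t(t + 1) = πⁱu³ + απⁿ⁻²ⁱ ∈ 𝔪`), or of *middle* shape `x = πʰx'`, `y = πʰy'` with `n = 2h` and
`y' ∈ Rˣ` (comparison of `π`-adic orders in `y(y + x) = x³ + απⁿ` when `2v(x) ≥ n`); cf. Silverman,
*ATAEC*, V.4, Lemma 4.1.2 (`0 < v(x(u)) = min(v(u), v(q) − v(u))` on the Tate curve). [folklore] -/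
theorem shape_of_bad (hϖ : Irreducible ϖ) (h1 : J.a₁ = 1) (h2 : J.a₂ = 0) (h3 : J.a₃ = 0)
    (h4 : J.a₄ = 0) {α : R} (hα : IsUnit α) {n : ℕ} (h6 : J.a₆ = α * ϖ ^ n) {x y : R}
    (hx : x ∈ maximalIdeal R) (he : J.toAffine.Equation x y) :
    (∃ (i : ℕ) (u t : R), 1 ≤ i ∧ 2 * i < n ∧ IsUnit u ∧ x = ϖ ^ i * u ∧ y = ϖ ^ i * u * t ∧
        (t ∈ maximalIdeal R ∨ t + 1 ∈ maximalIdeal R)) ∨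
      ∃ (h : ℕ) (x' y' : R), n = 2 * h ∧ IsUnit y' ∧ x = ϖ ^ h * x' ∧ y = ϖ ^ h * y' := by
  have hϖ0 : ϖ ≠ 0 := hϖ.ne_zero
  have hm : ϖ ∈ maximalIdeal R := (IsLocalRing.mem_maximalIdeal _).mpr hϖ.not_isUnit
  rw [WeierstrassCurve.Affine.equation_iff, h1, h2, h3, h4, h6] at he
  -- `he : y² + xy = x³ + α ϖⁿ` up to ring normalisation
  have he' : y * (y + x) = x ^ 3 + α * ϖ ^ n := by linear_combination he
  by_cases hx0 : x = 0
  · -- `x = 0`: `y² = α ϖⁿ`, middle shape with `x' = 0`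
    subst hx0
    have hy0 : y ≠ 0 := by
      rintro rfl; apply hα.ne_zero
      have : α * ϖ ^ n = 0 := by linear_combination -he
      exact (mul_eq_zero.mp this).resolve_right (pow_ne_zero _ hϖ0)
    obtain ⟨j, v, hv⟩ := IsDiscreteValuationRing.eq_unit_mul_pow_irreducible hy0 hϖ
    have hcmp : (↑(v ^ 2) : R) * ϖ ^ (2 * j) = ↑hα.unit * ϖ ^ n := by
      rw [Units.val_pow_eq_pow_val, hα.unit_spec]
      have h := he'
      rw [hv] at h
      ring_nf at h ⊢
      linear_combination h
    have hn : 2 * j = n := IsDiscreteValuationRing.unit_mul_pow_congr_pow hϖ hϖ _ _ _ _ hcmp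
    exact Or.inr ⟨j, 0, v, hn.symm, v.isUnit, by ring, by rw [hv]; ring⟩
  obtain ⟨i, u, hu⟩ := IsDiscreteValuationRing.eq_unit_mul_pow_irreducible hx0 hϖ
  have hi : 1 ≤ i := by
    refine Nat.one_le_iff_ne_zero.mpr fun h0 => ?_
    rw [h0, pow_zero, mul_one] at hu
    exact (IsLocalRing.mem_maximalIdeal _).mp hx (hu ▸ u.isUnit)
  rw [mul_comm] at hu
  by_cases hlow : 2 * i < n
  · -- low shape: `ϖ^i ∣ y`
    left
    have hdvd : ∀ k, k ≤ i → ϖ ^ k ∣ y := by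
      intro k hk
      induction k with
      | zero => exact ⟨y, by ring⟩
      | succ k ih =>
        obtain ⟨y₀, hy₀⟩ := ih (Nat.le_of_succ_le hk)
        refine pow_succ_dvd_of_pow_dvd_sq hϖ ?_
        have e : y ^ 2 = ϖ ^ (3 * i) * ↑u ^ 3 + α * ϖ ^ n - ϖ ^ (i + k) * (↑u * y₀) := by
          have h := he'
          rw [hu] at h
          linear_combination h - ϖ ^ i * ↑u * hy₀
        rw [e]
        refine Dvd.dvd.sub (Dvd.dvd.add ?_ ?_) ?_
        · exact dvd_mul_of_dvd_left (pow_dvd_pow ϖ (by omega)) _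
        · exact dvd_mul_of_dvd_right (pow_dvd_pow ϖ (by omega)) _
        · exact dvd_mul_of_dvd_left (pow_dvd_pow ϖ (by omega)) _
    obtain ⟨y₁, hy₁⟩ := hdvd i le_rfl
    obtain ⟨d, hd⟩ : ∃ d, n = 2 * i + (d + 1) := ⟨n - 2 * i - 1, by omega⟩
    obtain ⟨i₀, rfl⟩ : ∃ i₀, i = i₀ + 1 := ⟨i - 1, by omega⟩
    set t : R := y₁ * ↑u⁻¹ with ht
    have hyt : y = ϖ ^ (i₀ + 1) * ↑u * t := by
      rw [hy₁, ht, mul_assoc, mul_left_comm (↑u : R), Units.mul_inv, mul_one]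
    refine ⟨i₀ + 1, u, t, hi, hlow, u.isUnit, hu, hyt, ?_⟩
    have hprod : t * (t + 1) ∈ maximalIdeal R := by
      have e : (↑u : R) ^ 2 * (t * (t + 1)) = ϖ * (ϖ ^ i₀ * ↑u ^ 3 + α * ϖ ^ d) := by
        refine mul_left_cancel₀ (pow_ne_zero (2 * (i₀ + 1)) hϖ0) ?_
        have h := he'
        rw [hyt, hu, hd] at h
        calc ϖ ^ (2 * (i₀ + 1)) * (↑u ^ 2 * (t * (t + 1)))
            = ϖ ^ (i₀ + 1) * ↑u * t * (ϖ ^ (i₀ + 1) * ↑u * t + ϖ ^ (i₀ + 1) * ↑u) := by ring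
          _ = (ϖ ^ (i₀ + 1) * ↑u) ^ 3 + α * ϖ ^ (2 * (i₀ + 1) + (d + 1)) := h
          _ = ϖ ^ (2 * (i₀ + 1)) * (ϖ * (ϖ ^ i₀ * ↑u ^ 3 + α * ϖ ^ d)) := by ring
      have hmem : (↑u : R) ^ 2 * (t * (t + 1)) ∈ maximalIdeal R := e ▸ Ideal.mul_mem_right _ _ hm
      exact (Ideal.unit_mul_mem_iff_mem _ (u.isUnit.pow 2)).mp hmem
    exact (Ideal.IsPrime.mem_or_mem inferInstance hprod)
  · -- middle shape: `2 i ≥ n`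
    right
    rw [not_lt] at hlow
    obtain ⟨c, hc⟩ : ∃ c, 3 * i = n + (c + 1) := ⟨3 * i - n - 1, by omega⟩
    have hw : IsUnit (α + ϖ * (↑u ^ 3 * ϖ ^ c)) := isUnit_add_mul_of_isUnit hϖ hα _
    have hrhs : x ^ 3 + α * ϖ ^ n = ϖ ^ n * (α + ϖ * (↑u ^ 3 * ϖ ^ c)) := by
      rw [hu]
      calc (ϖ ^ i * ↑u) ^ 3 + α * ϖ ^ n = ϖ ^ (3 * i) * ↑u ^ 3 + α * ϖ ^ n := by ring
        _ = ϖ ^ n * (α + ϖ * (↑u ^ 3 * ϖ ^ c)) := by rw [hc]; ring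
    have hy0 : y ≠ 0 := by
      rintro rfl
      rw [zero_mul, hrhs] at he'
      exact hw.ne_zero ((mul_eq_zero.mp he'.symm).resolve_left (pow_ne_zero _ hϖ0))
    obtain ⟨j, v, hv⟩ := IsDiscreteValuationRing.eq_unit_mul_pow_irreducible hy0 hϖ
    rw [mul_comm] at hv
    rw [hrhs] at he'
    rcases lt_trichotomy j i with hji | rfl | hij
    · -- `j < i`: `y + x = ϖ^j · unit`, so `2 j = n`
      obtain ⟨c', hc'⟩ : ∃ c', i = j + (c' + 1) := ⟨i - j - 1, by omega⟩
      have hw₂ : IsUnit ((↑v : R) + ϖ * (↑u * ϖ ^ c')) := isUnit_add_mul_of_isUnit hϖ v.isUnit _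
      have hcmp : ↑(v * hw₂.unit) * ϖ ^ (2 * j) = ↑hw.unit * ϖ ^ n := by
        rw [Units.val_mul, hw₂.unit_spec, hw.unit_spec]
        calc (↑v * (↑v + ϖ * (↑u * ϖ ^ c'))) * ϖ ^ (2 * j) = y * (y + x) := by
              rw [hv, hu, hc']; ring
          _ = _ := he'
          _ = _ := mul_comm _ _
      have hn := IsDiscreteValuationRing.unit_mul_pow_congr_pow hϖ hϖ _ _ _ _ hcmp
      exact ⟨j, ↑u * ϖ ^ (c' + 1), v, hn.symm, v.isUnit, by rw [hu, hc']; ring, hv⟩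
    · -- `j = i`
      by_cases hvu : IsUnit ((↑v : R) + ↑u)
      · have hcmp : ↑(v * hvu.unit) * ϖ ^ (2 * j) = ↑hw.unit * ϖ ^ n := by
          rw [Units.val_mul, hvu.unit_spec, hw.unit_spec]
          calc (↑v * (↑v + ↑u)) * ϖ ^ (2 * j) = y * (y + x) := by rw [hv, hu]; ring
            _ = _ := he'
            _ = _ := mul_comm _ _
        have hn := IsDiscreteValuationRing.unit_mul_pow_congr_pow hϖ hϖ _ _ _ _ hcmp
        exact ⟨j, u, v, hn.symm, v.isUnit, hu, hv⟩
      · exfalso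
        obtain ⟨c₂, hc₂⟩ := (mem_maximalIdeal_iff_dvd_of_irreducible hϖ _).mp
          ((IsLocalRing.mem_maximalIdeal _).mpr hvu)
        have hdvd : ϖ ^ (2 * j + 1) ∣ ϖ ^ n := by
          refine (hw.dvd_mul_right).mp ⟨↑v * c₂, ?_⟩
          calc ϖ ^ n * (α + ϖ * (↑u ^ 3 * ϖ ^ c)) = y * (y + x) := he'.symm
            _ = ϖ ^ (2 * j + 1) * (↑v * c₂) := by
                rw [hv, hu, show ϖ ^ j * ↑v + ϖ ^ j * ↑u = ϖ ^ j * (↑v + ↑u) by ring, hc₂]; ring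
        have := (pow_dvd_pow_iff hϖ0 hϖ.not_isUnit).mp hdvd
        omega
    · -- `j > i`: `v(y (y + x)) = i + j > n`
      exfalso
      obtain ⟨c', hc'⟩ : ∃ c', j = i + (c' + 1) := ⟨j - i - 1, by omega⟩
      have hw₃ : IsUnit ((↑u : R) + ϖ * (↑v * ϖ ^ c')) := isUnit_add_mul_of_isUnit hϖ u.isUnit _
      have hcmp : ↑(v * hw₃.unit) * ϖ ^ (i + j) = ↑hw.unit * ϖ ^ n := by
        rw [Units.val_mul, hw₃.unit_spec, hw.unit_spec]
        calc (↑v * (↑u + ϖ * (↑v * ϖ ^ c'))) * ϖ ^ (i + j) = y * (y + x) := by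
              rw [hv, hu, hc']; ring
          _ = _ := he'
          _ = _ := mul_comm _ _
      have := IsDiscreteValuationRing.unit_mul_pow_congr_pow hϖ hϖ _ _ _ _ hcmp
      omega

end Tate

end LocalIndex

end Literature.NumberTheory.EllipticCurves

end
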